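import Summits.QuantumFields.YangMills.Theorems.SwapVirialDeficitBlowUpRingTaylor
import HarnessLib

/-!
# The massive-mode rung at fixed `L`, brick J5-R2: the QUATERNION HISTORY of the rebuilt ring along the blow-up is `C^∞` in the blow-up parameter
# (free-hands support of ⟨stmt-QuantumFields-24197⟩ `SwapVirialDeficit.SwapGluedStiffness`)

The pointwise input (P) of the shell (w3 g64's ✓`BlowUp.ae_shell_hP`) needs `t ↦ F^S_0(fixHistory (ringConfig 1 (blowUpPoint t x)))` to be `C²` at `0` for
`β`-a.e. blow-up point `x`.  fcl-p3 g45's quaternion deficit writes `F^S_z` as a smooth function of the LINK QUATERNIONS `su2Quat (P.1 i e)`, `su2Quat (P.2 x)`;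
this file proves that those link quaternions are `C^n` in `t` along the blow-up, for every `n`:

* §1 every link ∕ site of `fixHistory (ringConfig χ (C, U))` is a word of length `≤ 3` in the leaders, the followers and `χ` (`su2Quat_mul`), so
  ★★ `contDiff_su2Quat_fixHistory_fst` ∕ `contDiff_su2Quat_fixHistory_snd` ∕ `contDiff_quatHistory_ringConfig`: if `t ↦ su2Quat (C t μ)` (`μ : Fin 4`) and
  `t ↦ su2Quat (U t i)` (`i : Fol L`) are `C^n`, so is every link ∕ site quaternion of `fixHistory (ringConfig χ (C t, U t))` (constant `χ`), and the whole
  QUATERNION HISTORY `t ↦ ((i, e) ↦ su2Quat (link i e), x ↦ su2Quat (seam x))` as one `C^n` map into `(Fin (2L−1+1) → Edge 3 L → ℍ) × (Site 3 L → ℍ)`;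
* §2 at the blow-up point (fcl-p3 g45's ✓`…BlowUpRingTaylor` proves the same smoothness at a NON-DEGENERATE point directly: ✓`contDiff_quatHistory_blowUpPoint`,
  ✓`contDiff_chartDeficit_blowUpPoint`): ★ `ae_nondegenerate` — `β`-a.e. blow-up point IS non-degenerate at `t = 0` (hub `a ≠ 0`, `x̄ ≠ 0`, `ȳ ≠ 0`, `z₀ ≠ 0`,
  every follower `re yᵢ ≠ 0`; `β = cone ⊗ (vol³ ⊗ vol^{Fol})`; ✓`ae_ne_zero_coneMeasure`, ✓`volume_re_eq_zero`, `Measure.pi_eval_preimage_null`), hence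
  ★★ `ae_contDiff_quatHistory_blowUpPoint` and ★★ `ae_contDiff_chartDeficit_blowUpPoint` — `β`-a.e. the quaternion history and the σ-glued deficit along the
  blow-up are `C^n` on all of `ℝ`.

HONEST LABEL: calculus bookkeeping (plumbing for a plan-level fixed-`L` rung of a DRAFT line); (P) and the rung are assembled in the sequel
✓`…BlowUpPointwiseRing`, NOT here; NOT ⟨24197⟩; own crux ⟨22884⟩ OPEN (blocked-on ⟨19935⟩); the Yang–Mills mass gap is NOT proved; no summit is proved by a line.
THEOREMS ONLY (0 `def`, 0 `sorry`), standard axioms; the series' local `ℍ` instances.  Width seat ym-line-sfw-p2-w2 g57 (cell ym-idea-1, free hands),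
`--supports stmt-QuantumFields-24197`.  References: [cite: Luscher1983, §2]; [folklore].
-/

set_option autoImplicit false

noncomputable section

open MeasureTheory Quaternion Set Filter Topology
open scoped Quaternion ENNReal BigOperators ContDiff
open Literature.MathematicalPhysics.QuantumLattice
open Literature.MathematicalPhysics.QuantumFieldTheory hiding SU2
open Summit.QuantumFields.YangMills.Theorems.SwapTwistDeficit.ToronLog

attribute [local instance] Literature.Analysis.FluidPDE.Tao2016.quatMeasurableSpace
  Literature.Analysis.FluidPDE.Tao2016.quatBorelSpace
  Literature.MathematicalPhysics.QuantumLattice.secondCountableTopology_su2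

namespace Summit.QuantumFields.YangMills.Theorems.SwapVirialDeficit.BlowUpRing

open Summit.QuantumFields.YangMills.Theorems.FemtoTransferGap
open Summit.QuantumFields.YangMills.Theorems.FemtoTransferGap.TT
open Summit.QuantumFields.YangMills.Theorems.VirialFluxGap.RingDeficit
open Summit.QuantumFields.YangMills.Theorems.SwapVirialDeficit.SwapRing
open Summit.QuantumFields.YangMills.Theorems.SwapVirialDeficit.ZeroModeSigma (dil3 dilateIm axPart ae_ne_zero_coneMeasure)
open Summit.QuantumFields.YangMills.Theorems.SwapVirialDeficit.BlowUp (leaderTuple)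

variable {L : ℕ} [NeZero L]

/-! ## §1 Link quaternions of the rebuilt ring are words in the leader ∕ follower quaternions -/

section Words

variable {n : ℕ∞} {C : ℝ → Fin 4 → SU2} {U : ℝ → Fol L → SU2}

omit [NeZero L] in
/-- `su2Quat (glue w e)`: `1` on the tree, `su2Quat (w e)` off it. [folklore] -/
theorem su2Quat_glue (w : OffIdx L → SU2) (e : Edge 3 L) :
    su2Quat (glue w e) = if h : treeEdge e = true then (1 : ℍ) else su2Quat (w ⟨e, h⟩) := by
  by_cases h : treeEdge e = true
  · rw [glue_apply_of_tree _ h, dif_pos h, su2Quat_one]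
  · rw [glue_apply_of_not_tree _ h, dif_neg h]

/-- `ringConfig`, slice `0` at a leader link `i` (by the leader test). [folklore] -/
theorem ringConfig_fst_of_isLead (χ : Site 3 L → SU2) (q : (Fin 4 → SU2) × (Fol L → SU2)) {i : OffIdx L} (h : isLead i = true) :
    (ringConfig χ q).1 i = q.1 (Fin.castSucc i.1.2) := by
  simp only [ringConfig, sliceZero, dif_pos h]

omit [NeZero L] in
/-- The letter quaternion `t ↦ su2Quat (letter (C t ∘ castSucc) i)` is `C^n` if the leaders are. [folklore] -/
theorem contDiff_su2Quat_letter_of_paths (hC : ∀ μ : Fin 4, ContDiff ℝ n fun t => su2Quat (C t μ)) (i : OffIdx L) :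
    ContDiff ℝ n fun t => su2Quat (letter (fun μ => C t (Fin.castSucc μ)) i) := by
  by_cases h : i.1.1 i.1.2 = -1
  · simp only [letter, h, if_true]; exact hC _
  · simp only [letter, h, if_false, su2Quat_one]; exact contDiff_const

/-- ★ **Slice `0` quaternions are `C^n`**: leaders verbatim, other links `letter · U`. [folklore] -/
theorem contDiff_su2Quat_ringConfig_fst (χ : Site 3 L → SU2) (hC : ∀ μ : Fin 4, ContDiff ℝ n fun t => su2Quat (C t μ))
    (hU : ∀ i : Fol L, ContDiff ℝ n fun t => su2Quat (U t i)) (i : OffIdx L) :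
    ContDiff ℝ n fun t => su2Quat ((ringConfig χ (C t, U t)).1 i) := by
  by_cases h : isLead i = true
  · simp only [ringConfig_fst_of_isLead χ _ h]; exact hC _
  · have e : (fun t => su2Quat ((ringConfig χ (C t, U t)).1 i)) =
        fun t => su2Quat (letter (fun μ => C t (Fin.castSucc μ)) i) * su2Quat (U t (Sum.inl ⟨i, h⟩)) := by
      funext t
      rw [← su2Quat_mul]
      exact congrArg su2Quat (ringConfig_fst_of_not_isLead χ (C t, U t) ⟨i, h⟩)
    rw [e]
    exact (contDiff_su2Quat_letter_of_paths hC i).mul (hU _)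

/-- ★ **Glued slice-`0` quaternions are `C^n`.** [folklore] -/
theorem contDiff_su2Quat_glue_ringConfig (χ : Site 3 L → SU2) (hC : ∀ μ : Fin 4, ContDiff ℝ n fun t => su2Quat (C t μ))
    (hU : ∀ i : Fol L, ContDiff ℝ n fun t => su2Quat (U t i)) (e : Edge 3 L) :
    ContDiff ℝ n fun t => su2Quat (glue (ringConfig χ (C t, U t)).1 e) := by
  by_cases h : treeEdge e = true
  · simp only [su2Quat_glue, h, dif_pos]; exact contDiff_const
  · simp only [su2Quat_glue, h]
    exact contDiff_su2Quat_ringConfig_fst χ hC hU ⟨e, h⟩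

/-- ★ **Slice-`j` quaternions (`j ≥ 1`) are `C^n`**: `glue(w) e · U_(j,e)`. [folklore] -/
theorem contDiff_su2Quat_ringConfig_snd_fst (χ : Site 3 L → SU2) (hC : ∀ μ : Fin 4, ContDiff ℝ n fun t => su2Quat (C t μ))
    (hU : ∀ i : Fol L, ContDiff ℝ n fun t => su2Quat (U t i)) (j : Fin (2 * L - 1)) (e : Edge 3 L) :
    ContDiff ℝ n fun t => su2Quat ((ringConfig χ (C t, U t)).2.1 j e) := by
  have e' : (fun t => su2Quat ((ringConfig χ (C t, U t)).2.1 j e)) =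
      fun t => su2Quat (glue (ringConfig χ (C t, U t)).1 e) * su2Quat (U t (Sum.inr (Sum.inl (j, e)))) := by
    funext t; rw [ringConfig_snd_fst, su2Quat_mul]
  rw [e']
  exact (contDiff_su2Quat_glue_ringConfig χ hC hU e).mul (hU _)

/-- ★ **Seam quaternions are `C^n`**: `c` at the origin, `χ(x)·c·U_x` elsewhere. [folklore] -/
theorem contDiff_su2Quat_ringConfig_snd_snd (χ : Site 3 L → SU2) (hC : ∀ μ : Fin 4, ContDiff ℝ n fun t => su2Quat (C t μ))
    (hU : ∀ i : Fol L, ContDiff ℝ n fun t => su2Quat (U t i)) (x : Site 3 L) :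
    ContDiff ℝ n fun t => su2Quat ((ringConfig χ (C t, U t)).2.2 x) := by
  by_cases h : x = 0
  · subst h
    simp only [ringConfig_snd_snd_zero]; exact hC _
  · have e : (fun t => su2Quat ((ringConfig χ (C t, U t)).2.2 x)) =
        fun t => su2Quat (χ x) * su2Quat (C t (Fin.last 3)) * su2Quat (U t (Sum.inr (Sum.inr ⟨x, h⟩))) := by
      funext t
      rw [← su2Quat_mul, ← su2Quat_mul]
      exact congrArg su2Quat (ringConfig_snd_snd_of_ne χ (C t, U t) ⟨x, h⟩)
    rw [e]
    exact (contDiff_const.mul (hC _)).mul (hU _)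

/-- ★★ **Every link quaternion of the rebuilt ring history is `C^n`** (slice `0` = `glue w`, slices `j ≥ 1` = `r_j`). [folklore] -/
theorem contDiff_su2Quat_fixHistory_fst (χ : Site 3 L → SU2) (hC : ∀ μ : Fin 4, ContDiff ℝ n fun t => su2Quat (C t μ))
    (hU : ∀ i : Fol L, ContDiff ℝ n fun t => su2Quat (U t i)) (i : Fin (2 * L - 1 + 1)) (e : Edge 3 L) :
    ContDiff ℝ n fun t => su2Quat ((fixHistory (ringConfig χ (C t, U t))).1 i e) := by
  refine Fin.cases ?_ (fun j => ?_) i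
  · simp only [fixHistory, Fin.cons_zero]; exact contDiff_su2Quat_glue_ringConfig χ hC hU e
  · simp only [fixHistory, Fin.cons_succ]; exact contDiff_su2Quat_ringConfig_snd_fst χ hC hU j e

/-- ★★ **Every seam quaternion of the rebuilt ring history is `C^n`.** [folklore] -/
theorem contDiff_su2Quat_fixHistory_snd (χ : Site 3 L → SU2) (hC : ∀ μ : Fin 4, ContDiff ℝ n fun t => su2Quat (C t μ))
    (hU : ∀ i : Fol L, ContDiff ℝ n fun t => su2Quat (U t i)) (x : Site 3 L) :
    ContDiff ℝ n fun t => su2Quat ((fixHistory (ringConfig χ (C t, U t))).2 x) :=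
  contDiff_su2Quat_ringConfig_snd_snd χ hC hU x

/-- ★★ **THE QUATERNION HISTORY IS `C^n`** as one map `ℝ → (Fin (2L−1+1) → Edge 3 L → ℍ) × (Site 3 L → ℍ)`. [folklore] -/
theorem contDiff_quatHistory_ringConfig (χ : Site 3 L → SU2) (hC : ∀ μ : Fin 4, ContDiff ℝ n fun t => su2Quat (C t μ))
    (hU : ∀ i : Fol L, ContDiff ℝ n fun t => su2Quat (U t i)) :
    ContDiff ℝ n fun t => ((fun (i : Fin (2 * L - 1 + 1)) (e : Edge 3 L) => su2Quat ((fixHistory (ringConfig χ (C t, U t))).1 i e)),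
      (fun x : Site 3 L => su2Quat ((fixHistory (ringConfig χ (C t, U t))).2 x))) := by
  refine ContDiff.prodMk ?_ ?_
  · exact contDiff_pi.2 fun i => contDiff_pi.2 fun e => contDiff_su2Quat_fixHistory_fst χ hC hU i e
  · exact contDiff_pi.2 fun x => contDiff_su2Quat_fixHistory_snd χ hC hU x

end Words

/-! ## §2 Along the blow-up: non-degenerate points, and almost every point is non-degenerate -/

/-- Lebesgue-a.e. quaternion has non-zero real part, hence non-zero axial part. [folklore] -/
theorem ae_re_ne_zero_and_axPart_ne_zero : ∀ᵐ q : ℍ ∂(volume : Measure ℍ), q.re ≠ 0 ∧ axPart q ≠ 0 := by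
  have h0 : ∀ᵐ q : ℍ ∂(volume : Measure ℍ), q.re ≠ 0 := by
    rw [ae_iff]; simpa only [ne_eq, not_not] using Literature.MathematicalPhysics.QuantumLattice.volume_re_eq_zero
  filter_upwards [h0] with q hq
  refine ⟨hq, fun h => hq ?_⟩
  have := congrArg (fun p : ℍ => p.re) h
  simpa [axPart] using this

/-- ★ **`β`-a.e. blow-up point is non-degenerate at `t = 0`**: hub `a ≠ 0`, `x̄ ≠ 0`, `ȳ ≠ 0`, `z₀ ≠ 0`, every follower `re yᵢ ≠ 0`. [folklore] -/
theorem ae_nondegenerate :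
    ∀ᵐ x : ℍ × (((ℍ × ℍ) × ℍ) × (Fol L → ℍ)) ∂(coneMeasure.prod ((volume : Measure ((ℍ × ℍ) × ℍ)).prod
      (Measure.pi fun _ : Fol L => (volume : Measure ℍ)))),
      x.1 ≠ 0 ∧ axPart x.2.1.1.1 ≠ 0 ∧ axPart x.2.1.1.2 ≠ 0 ∧ x.2.1.2.re ≠ 0 ∧ ∀ i, (x.2.2 i).re ≠ 0 := by
  haveI := isProbabilityMeasure_coneMeasure
  -- the three cone letters
  have hw : ∀ᵐ w : (ℍ × ℍ) × ℍ ∂(volume : Measure ((ℍ × ℍ) × ℍ)), axPart w.1.1 ≠ 0 ∧ axPart w.1.2 ≠ 0 ∧ w.2.re ≠ 0 := by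
    have h12 : ∀ᵐ p : ℍ × ℍ ∂(volume : Measure (ℍ × ℍ)), axPart p.1 ≠ 0 ∧ axPart p.2 ≠ 0 := by
      have a1 := (Measure.quasiMeasurePreserving_fst (μ := (volume : Measure ℍ)) (ν := (volume : Measure ℍ))).ae
        ae_re_ne_zero_and_axPart_ne_zero
      have a2 := (Measure.quasiMeasurePreserving_snd (μ := (volume : Measure ℍ)) (ν := (volume : Measure ℍ))).ae
        ae_re_ne_zero_and_axPart_ne_zero
      filter_upwards [a1, a2] with p h1 h2 using ⟨h1.2, h2.2⟩
    have b1 := (Measure.quasiMeasurePreserving_fst (μ := (volume : Measure (ℍ × ℍ))) (ν := (volume : Measure ℍ))).ae h12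
    have b2 := (Measure.quasiMeasurePreserving_snd (μ := (volume : Measure (ℍ × ℍ))) (ν := (volume : Measure ℍ))).ae
      ae_re_ne_zero_and_axPart_ne_zero
    filter_upwards [b1, b2] with w h1 h2 using ⟨h1.1, h1.2, h2.1⟩
  -- the followers
  have hy : ∀ᵐ y : Fol L → ℍ ∂(Measure.pi fun _ : Fol L => (volume : Measure ℍ)), ∀ i, (y i).re ≠ 0 := by
    refine ae_all_iff.2 fun i => ?_
    have h0 : (Measure.pi fun _ : Fol L => (volume : Measure ℍ)) {y : Fol L → ℍ | (y i).re = 0} = 0 :=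
      Measure.pi_eval_preimage_null (fun _ : Fol L => (volume : Measure ℍ)) Literature.MathematicalPhysics.QuantumLattice.volume_re_eq_zero
    rw [ae_iff]
    simpa only [ne_eq, not_not] using h0
  have hwy : ∀ᵐ m : ((ℍ × ℍ) × ℍ) × (Fol L → ℍ) ∂((volume : Measure ((ℍ × ℍ) × ℍ)).prod (Measure.pi fun _ : Fol L => (volume : Measure ℍ))),
      (axPart m.1.1.1 ≠ 0 ∧ axPart m.1.1.2 ≠ 0 ∧ m.1.2.re ≠ 0) ∧ ∀ i, (m.2 i).re ≠ 0 := by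
    have c1 := (Measure.quasiMeasurePreserving_fst (μ := (volume : Measure ((ℍ × ℍ) × ℍ)))
      (ν := Measure.pi fun _ : Fol L => (volume : Measure ℍ))).ae hw
    have c2 := (Measure.quasiMeasurePreserving_snd (μ := (volume : Measure ((ℍ × ℍ) × ℍ)))
      (ν := Measure.pi fun _ : Fol L => (volume : Measure ℍ))).ae hy
    filter_upwards [c1, c2] with m h1 h2 using ⟨h1, h2⟩
  have d1 := (Measure.quasiMeasurePreserving_fst (μ := coneMeasure)
    (ν := (volume : Measure ((ℍ × ℍ) × ℍ)).prod (Measure.pi fun _ : Fol L => (volume : Measure ℍ)))).ae ae_ne_zero_coneMeasure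
  have d2 := (Measure.quasiMeasurePreserving_snd (μ := coneMeasure)
    (ν := (volume : Measure ((ℍ × ℍ) × ℍ)).prod (Measure.pi fun _ : Fol L => (volume : Measure ℍ)))).ae hwy
  filter_upwards [d1, d2] with x h1 h2 using ⟨h1, h2.1.1, h2.1.2.1, h2.1.2.2, h2.2⟩

/-- ★★ **`β`-a.e. the quaternion history along the blow-up is `C^n` on all of `ℝ`.** [folklore] -/
theorem ae_contDiff_quatHistory_blowUpPoint {n : ℕ∞} (χ : Site 3 L → SU2) :
    ∀ᵐ x : ℍ × (((ℍ × ℍ) × ℍ) × (Fol L → ℍ)) ∂(coneMeasure.prod ((volume : Measure ((ℍ × ℍ) × ℍ)).prod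
      (Measure.pi fun _ : Fol L => (volume : Measure ℍ)))),
      ContDiff ℝ n fun t => ((fun (i : Fin (2 * L - 1 + 1)) (e : Edge 3 L) => su2Quat ((fixHistory (ringConfig χ (blowUpPoint t x))).1 i e)),
        (fun s : Site 3 L => su2Quat ((fixHistory (ringConfig χ (blowUpPoint t x))).2 s))) := by
  filter_upwards [ae_nondegenerate (L := L)] with x hx
  exact contDiff_quatHistory_blowUpPoint χ hx.1 hx.2.1 hx.2.2.1 hx.2.2.2.1 hx.2.2.2.2

/-- ★★ **`β`-a.e. the σ-glued deficit along the blow-up, `t ↦ chartDeficit L z χ (blowUpPoint t x)`, is `C^n` on all of `ℝ`** (fcl-p3 g45's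
✓`contDiff_chartDeficit_blowUpPoint` at the `β`-a.e. non-degenerate point). [cite: Luscher1983, §2] -/
theorem ae_contDiff_chartDeficit_blowUpPoint {n : ℕ∞} (z : Fin 3 → Bool) (χ : Site 3 L → SU2) :
    ∀ᵐ x : ℍ × (((ℍ × ℍ) × ℍ) × (Fol L → ℍ)) ∂(coneMeasure.prod ((volume : Measure ((ℍ × ℍ) × ℍ)).prod
      (Measure.pi fun _ : Fol L => (volume : Measure ℍ)))),
      ContDiff ℝ n fun t : ℝ => chartDeficit L z χ (blowUpPoint t x) := by
  filter_upwards [ae_nondegenerate (L := L)] with x hx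
  exact contDiff_chartDeficit_blowUpPoint z χ hx.1 hx.2.1 hx.2.2.1 hx.2.2.2.1 hx.2.2.2.2

end Summit.QuantumFields.YangMills.Theorems.SwapVirialDeficit.BlowUpRing

end
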